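import Summits.QuantumFields.BalabanUV.Beta.GAN24.MixedSlotCarrier

/-!
# `BalabanUV.Beta.GAN24.StepDifferenceThreeWindows` — binder row G-an2-4 ∕ (CONV-C), W-slot, the (α-0) parity re-cut, located crux (Q-L-k₀), the DRIFT rows
# (leaf-03 g68 FILE 4 v4 `HΔw`; OWNER `b2b-balaban-gan24-p1` gen 37, part 10): **THE `HΔw` OBJECT IS THE SUM OF THREE MIXED WINDOWS.**

NOT IN PRINT; OUR BOOKKEEPING ([folklore] linearity bookkeeping on leaf-03's `Lin4LegTowerUnroll` (`legStepB`, `legChain`, `bsumPow`, the bounded class) and MY part 9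
`MixedSlotCarrier` (`legStep₃`, `legStep_sub_legStep_eq_three`); 0 `def`, 0 cited facts, 0 `def … : Prop`, 0 sorry).  HONEST FRAMING (cell contract, verbatim):
«discharging `BetaPertH` makes Bałaban's UV stability UNCONDITIONAL — a real constructive-QFT result; it is NOT the continuum limit and NOT the Clay problem.»  HONEST
DEPENDENCY (verbatim): «continuum YM on T⁴ ⇐ BetaPertH ∧ nine spine estimates (0/9 proved); BetaPertH ⇐ (D1) ∧ (D4) ∧ CAP+tail; G-an2-4 gates asym, D1 and NE2/3/4.»

WHAT (generic `d`; a kernel family `K` with every level decaying, a level-`l`-constant scalar `kc (l+1) = kc l`, a BOUNDED table `W`):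
* §1 the bounded class: `bdd_legStep₃` (MY part 9's mixed step preserves bounded tables), `decays_sub_min`;
* §2 linearity of the window map `X ↦ legChain kc K N m k (bsumPow N q ∘ X)` on bounded tables: `bsum_add'`, `bsumPow_add`, `legChain_add`;
* §3 **`legChain_stepDiff_eq_three`** (and its corollary **`locStencil₂_stepDiff_of_three`**: three mixed-window `LocStencil₂` bounds ⟹ the `HΔw` bound with the constants added) — VERBATIM ON leaf-03 g68 FILE 4 v4's `HΔw` OBJECT:
  `legChain kc K N (l+2) q (fun s ↦ bsumPow N q ((legStepB kc K N (l+1) W − legStepB kc K N l W) s))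
     = Σ_{i=1}^{3} legChain kc K N (l+2) q (fun s ↦ bsumPow N q (legStep₃ (kc l) G₁⁽ⁱ⁾ G₂⁽ⁱ⁾ K⁽ⁱ⁾ N (𝔹W) s))`
  with `(G₁,G₂,K)⁽¹⁾ = (K_{l+1} − K_l, K_{l+1}, K_{l+1})`, `⁽²⁾ = (K_l, K_{l+1} − K_l, K_{l+1})`, `⁽³⁾ = (K_l, K_l, K_{l+1} − K_l)` — three `q`-windows of the natural family over ONE
  mixed step each, every one carrying EXACTLY ONE difference leg.  With `K := K♮ᴱ(rr)` and MY part 7 (`Decays (K♮_{l+1} − K♮_l) (cK·θ^l) δ`) this is the input of the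
  mixed carrier bounds ((ii)₂∕(iii)₂, leaf-01's — SPEC `HOME/b2b-balaban-gan24-p1/gen37/SPEC-H1Dw-mixed-carrier.md`) and of the socket call (`locStencil₂_add` twice).
Asserts NOTHING about Bałaban's tables; NOT (H1Δw); NOTHING of (Q-L) ∕ (C)sym discharged; NEVER «G-an2-4 closed» as (CONV-C); NOT D1, NOT `BetaPertH`, NOT continuum,
NOT Clay; not in print.  Unit `b2b-balaban-gan24-p1` (BINDER row G-an2-4 OWNER; CRUX PROVER on C-R8° CT-ROUTE), gen 37, 2026-08-23.
-/

noncomputable section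

open Finset
open scoped BigOperators
open Literature.MathematicalPhysics.QuantumFieldTheory
open Literature.MathematicalPhysics.QuantumFieldTheory.Balaban1983to89
open Literature.MathematicalPhysics.QuantumFieldTheory.Balaban1983to89.Beta
open B12Sec2to5 (l1 l1_nonneg)
open ExpKernelCalculus (MKer Site Decays comp Zl Zl_nonneg)
open OneStepResolventKernel (Fib)
open KernelWard (Bdd)
open Summit.QuantumFields.BalabanUV.Beta.GAN24.Lin4Additive (bdd_comp_decays_bdd)
open Summit.QuantumFields.BalabanUV.Beta.GAN24.Lin4LegTower (bsum bsum_apply mreadL legStep legStep_inl legStep_inr)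
open Summit.QuantumFields.BalabanUV.Beta.GAN24.Lin4LegTowerTwo (bdd_bsum legStep_add')
open Summit.QuantumFields.BalabanUV.Beta.GAN24.Lin4LegTowerUnroll (legStepB bsumPow legChain bddTab_bsumPow bddTab_legChain)
open Summit.QuantumFields.BalabanUV.Beta.GAN24.MixedSlotCarrier (vsym₂ legStep₃ legStep₃_self abs_vsym₂_le legStep_sub_legStep_eq_three)
open Summit.QuantumFields.BalabanUV.Beta.GAN24.BiStencilZeroMode (Tab)

namespace Summit.QuantumFields.BalabanUV.Beta.GAN24.StepDifferenceThreeWindows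

variable {d : ℕ}

/-! ## §1 The bounded class -/

/-- [folklore] The difference of two decaying kernels decays (sum of constants, smaller rate). -/
theorem decays_sub_min {A B : MKer (d + 1) (Fib d)} {CA δA CB δB : ℝ} (hA : Decays A CA δA) (hB : Decays B CB δB) (hCA : 0 ≤ CA) (hCB : 0 ≤ CB) :
    Decays (A - B) (CA + CB) (min δA δB) := by
  intro x y a b
  have h1 := hA x y a b
  have h2 := hB x y a b
  have hl := l1_nonneg (x - y)
  have e1 : Real.exp (-δA * l1 (x - y)) ≤ Real.exp (-(min δA δB) * l1 (x - y)) :=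
    Real.exp_le_exp.2 (by nlinarith [min_le_left δA δB])
  have e2 : Real.exp (-δB * l1 (x - y)) ≤ Real.exp (-(min δA δB) * l1 (x - y)) :=
    Real.exp_le_exp.2 (by nlinarith [min_le_right δA δB])
  rw [Pi.sub_apply, Pi.sub_apply, Pi.sub_apply, Pi.sub_apply]
  calc |A x y a b - B x y a b| ≤ |A x y a b| + |B x y a b| := abs_sub _ _
    _ ≤ CA * Real.exp (-(min δA δB) * l1 (x - y)) + CB * Real.exp (-(min δA δB) * l1 (x - y)) :=
        add_le_add (h1.trans (mul_le_mul_of_nonneg_left e1 hCA)) (h2.trans (mul_le_mul_of_nonneg_left e2 hCB))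
    _ = (CA + CB) * Real.exp (-(min δA δB) * l1 (x - y)) := by ring

/-- [folklore] A decaying kernel's constant is nonnegative. -/
theorem nonneg_of_decays {A : MKer (d + 1) (Fib d)} {C δ : ℝ} (hA : Decays A C δ) : 0 ≤ C := by
  have h := hA 0 0 (Sum.inl 0) (Sum.inl 0)
  rw [sub_self] at h
  have : l1 (0 : Fin (d + 1) → ℤ) = 0 := by unfold l1; simp
  rw [this, mul_zero, Real.exp_zero, mul_one] at h
  exact (abs_nonneg _).trans h

variable {G₁ G₂ K : MKer (d + 1) (Fib d)} {C₁ δ₁ C₂ δ₂ CK δK B B' : ℝ} {N : ℕ}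

/-- [folklore] **THE MIXED STEP PRESERVES THE BOUNDED CLASS** (constant `|kc|·|F|·C_K Zl(δ_K)·` part 9's `abs_vsym₂_le` constant). -/
theorem bdd_legStep₃ (hG₁ : Decays G₁ C₁ δ₁) (hδ₁ : 0 < δ₁) (hG₂ : Decays G₂ C₂ δ₂) (hδ₂ : 0 < δ₂) (hK : Decays K CK δK) (hδK : 0 < δK) (kc : ℝ)
    {W : Tab d} (hW : ∀ κ u κ' u' x z a b, |W κ u κ' u' x z a b| ≤ B)
    (κ : Fin (d + 1)) (u : Fin (d + 1) → ℤ) (κ' : Fin (d + 1)) (u' : Fin (d + 1) → ℤ) (x z : Fin (d + 1) → ℤ) (a b : Fib d) :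
    |legStep₃ kc G₁ G₂ K N W κ u κ' u' x z a b| ≤ |kc| * ((Fintype.card (Fib d) : ℝ) * (CK * Zl (d + 1) δK *
      (((d + 1 : ℕ) : ℝ) * (C₁ * Zl (d + 1) δ₁ * (((d + 1 : ℕ) : ℝ) * (C₂ * Zl (d + 1) δ₂ * B)))))) := by
  have hV := abs_vsym₂_le (N := N) hG₁ hδ₁ hG₂ hδ₂ hW κ u κ' u'
  have hKV := bdd_comp_decays_bdd hK hδK hV
  have h0 : 0 ≤ (Fintype.card (Fib d) : ℝ) * (CK * Zl (d + 1) δK *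
      (((d + 1 : ℕ) : ℝ) * (C₁ * Zl (d + 1) δ₁ * (((d + 1 : ℕ) : ℝ) * (C₂ * Zl (d + 1) δ₂ * B))))) :=
    (abs_nonneg _).trans (hKV 0 0 (Sum.inl 0) (Sum.inl 0))
  unfold legStep₃
  rw [Pi.smul_apply, Pi.smul_apply, Pi.smul_apply, Pi.smul_apply, smul_eq_mul, abs_mul]
  refine mul_le_mul_of_nonneg_left ?_ (abs_nonneg _)
  rcases a with α | ρ
  · exact hKV _ _ _ _
  · show |(0 : ℝ)| ≤ _
    rw [abs_zero]; exact h0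

/-! ## §2 Linearity of the window map on bounded tables -/

/-- [folklore] `bsum` is additive (pointwise form of leaf-03's `bsum_add`). -/
theorem bsum_add' (N : ℕ) (F G : MKer (d + 1) (Fib d)) : bsum N (fun x z a b => F x z a b + G x z a b) = bsum N F + bsum N G := by
  funext x z a b
  rw [Pi.add_apply, Pi.add_apply, Pi.add_apply, Pi.add_apply, bsum_apply, bsum_apply, bsum_apply, ← Finset.sum_add_distrib]

/-- [folklore] The `q`-fold block sum is additive. -/
theorem bsumPow_add (N : ℕ) : ∀ (q : ℕ) (F G : MKer (d + 1) (Fib d)), bsumPow N q (F + G) = bsumPow N q F + bsumPow N q G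
  | 0, _, _ => rfl
  | q + 1, F, G => by
    show bsum N (bsumPow N q (F + G)) = bsum N (bsumPow N q F) + bsum N (bsumPow N q G)
    rw [bsumPow_add N q F G, ← bsum_add']
    rfl

variable {kc : ℕ → ℝ} {Kf : ℕ → MKer (d + 1) (Fib d)}

/-- [folklore] **THE SOURCE CHAIN IS ADDITIVE ON BOUNDED TABLES** (every level decaying; leaf-03's `legStep_add'` level by level, the bounded class by `bddTab_legChain`). -/
theorem legChain_add (hK : ∀ n, ∃ δ C : ℝ, 0 < δ ∧ Decays (Kf n) C δ) (m : ℕ) :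
    ∀ (k : ℕ) {X Y : Tab d}, (∃ BX : ℝ, ∀ κ u κ' u' x z a b, |X κ u κ' u' x z a b| ≤ BX) → (∃ BY : ℝ, ∀ κ u κ' u' x z a b, |Y κ u κ' u' x z a b| ≤ BY) →
      legChain kc Kf N m k (X + Y) = legChain kc Kf N m k X + legChain kc Kf N m k Y
  | 0, _, _, _, _ => rfl
  | k + 1, X, Y, hX, hY => by
    obtain ⟨δ, C, hδ, hKn⟩ := hK (m + k)
    obtain ⟨BX, hBX⟩ := bddTab_legChain (kc := kc) (N := N) hK m k hX
    obtain ⟨BY, hBY⟩ := bddTab_legChain (kc := kc) (N := N) hK m k hY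
    funext κ u κ' u'
    show legStep (kc (m + k)) (Kf (m + k)) (Kf (m + k)) N (legChain kc Kf N m k (X + Y)) κ u κ' u'
      = legStep (kc (m + k)) (Kf (m + k)) (Kf (m + k)) N (legChain kc Kf N m k X) κ u κ' u'
        + legStep (kc (m + k)) (Kf (m + k)) (Kf (m + k)) N (legChain kc Kf N m k Y) κ u κ' u'
    rw [legChain_add hK m k hX hY]
    exact legStep_add' hKn hδ hKn hδ (kc (m + k)) hBX hBY κ u κ' u'

/-- [folklore] The window map `X ↦ legChain kc K N m k (bsumPow N q ∘ X)` is additive on bounded tables. -/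
theorem legChain_bsumPow_add (hK : ∀ n, ∃ δ C : ℝ, 0 < δ ∧ Decays (Kf n) C δ) (m k q : ℕ) {X Y : Tab d}
    (hX : ∃ BX : ℝ, ∀ κ u κ' u' x z a b, |X κ u κ' u' x z a b| ≤ BX) (hY : ∃ BY : ℝ, ∀ κ u κ' u' x z a b, |Y κ u κ' u' x z a b| ≤ BY) :
    legChain kc Kf N m k (fun κ u κ' u' => bsumPow N q ((X + Y) κ u κ' u'))
      = legChain kc Kf N m k (fun κ u κ' u' => bsumPow N q (X κ u κ' u')) + legChain kc Kf N m k (fun κ u κ' u' => bsumPow N q (Y κ u κ' u')) := by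
  have e : (fun κ u κ' u' => bsumPow N q ((X + Y) κ u κ' u'))
      = (fun κ u κ' u' => bsumPow N q (X κ u κ' u')) + fun κ u κ' u' => bsumPow N q (Y κ u κ' u') := by
    funext κ u κ' u'
    show bsumPow N q (X κ u κ' u' + Y κ u κ' u') = _
    rw [bsumPow_add]
    rfl
  rw [e]
  exact legChain_add hK m k (bddTab_bsumPow hX q) (bddTab_bsumPow hY q)

/-! ## §3 The `HΔw` object is the sum of three mixed windows -/

/-- NOT IN PRINT; OUR BOOKKEEPING.  **THE `HΔw` OBJECT IS THE SUM OF THREE MIXED WINDOWS** (as displayed in the module docstring; `K` levelwise decaying,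
`kc (l+1) = kc l`, `W` bounded; `𝔹W := fun s ↦ bsum N (W s)`). -/
theorem legChain_stepDiff_eq_three (hK : ∀ n, ∃ δ C : ℝ, 0 < δ ∧ Decays (Kf n) C δ) {l : ℕ} (hkc : kc (l + 1) = kc l) (q : ℕ)
    {W : Tab d} (hW : ∃ B : ℝ, ∀ κ u κ' u' x z a b, |W κ u κ' u' x z a b| ≤ B) :
    legChain kc Kf N (l + 2) q (fun κ u κ' u' => bsumPow N q ((legStepB kc Kf N (l + 1) W - legStepB kc Kf N l W) κ u κ' u'))
      = legChain kc Kf N (l + 2) q (fun κ u κ' u' => bsumPow N q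
            (legStep₃ (kc l) (Kf (l + 1) - Kf l) (Kf (l + 1)) (Kf (l + 1)) N (fun κ u κ' u' => bsum N (W κ u κ' u')) κ u κ' u'))
        + legChain kc Kf N (l + 2) q (fun κ u κ' u' => bsumPow N q
            (legStep₃ (kc l) (Kf l) (Kf (l + 1) - Kf l) (Kf (l + 1)) N (fun κ u κ' u' => bsum N (W κ u κ' u')) κ u κ' u'))
        + legChain kc Kf N (l + 2) q (fun κ u κ' u' => bsumPow N q
            (legStep₃ (kc l) (Kf l) (Kf l) (Kf (l + 1) - Kf l) N (fun κ u κ' u' => bsum N (W κ u κ' u')) κ u κ' u')) := by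
  obtain ⟨δ₀, C₀, hδ₀, hK₀⟩ := hK l
  obtain ⟨δ₁, C₁, hδ₁, hK₁⟩ := hK (l + 1)
  obtain ⟨B, hB⟩ := hW
  have hC₀ := nonneg_of_decays hK₀
  have hC₁ := nonneg_of_decays hK₁
  -- the block-summed table is bounded
  have hBW : ∀ κ u κ' u' x z a b, |(fun κ u κ' u' => bsum N (W κ u κ' u')) κ u κ' u' x z a b| ≤ ((N : ℝ) ^ (d + 1)) * B :=
    fun κ u κ' u' x z a b => bdd_bsum N (fun x z a b => hB κ u κ' u' x z a b) x z a b
  -- the difference kernel decays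
  have hΔ := decays_sub_min hK₁ hK₀ hC₁ hC₀
  have hδm : 0 < min δ₁ δ₀ := lt_min hδ₁ hδ₀
  -- the three mixed steps are bounded tables
  have hbT₁ : ∃ B₁ : ℝ, ∀ κ u κ' u' x z a b, |(fun κ u κ' u' =>
      legStep₃ (kc l) (Kf (l + 1) - Kf l) (Kf (l + 1)) (Kf (l + 1)) N (fun κ u κ' u' => bsum N (W κ u κ' u')) κ u κ' u') κ u κ' u' x z a b| ≤ B₁ :=
    ⟨_, fun κ u κ' u' x z a b => bdd_legStep₃ (N := N) hΔ hδm hK₁ hδ₁ hK₁ hδ₁ (kc l) hBW κ u κ' u' x z a b⟩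
  have hbT₂ : ∃ B₂ : ℝ, ∀ κ u κ' u' x z a b, |(fun κ u κ' u' =>
      legStep₃ (kc l) (Kf l) (Kf (l + 1) - Kf l) (Kf (l + 1)) N (fun κ u κ' u' => bsum N (W κ u κ' u')) κ u κ' u') κ u κ' u' x z a b| ≤ B₂ :=
    ⟨_, fun κ u κ' u' x z a b => bdd_legStep₃ (N := N) hK₀ hδ₀ hΔ hδm hK₁ hδ₁ (kc l) hBW κ u κ' u' x z a b⟩
  have hbT₃ : ∃ B₃ : ℝ, ∀ κ u κ' u' x z a b, |(fun κ u κ' u' =>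
      legStep₃ (kc l) (Kf l) (Kf l) (Kf (l + 1) - Kf l) N (fun κ u κ' u' => bsum N (W κ u κ' u')) κ u κ' u') κ u κ' u' x z a b| ≤ B₃ :=
    ⟨_, fun κ u κ' u' x z a b => bdd_legStep₃ (N := N) hK₀ hδ₀ hK₀ hδ₀ hΔ hδm (kc l) hBW κ u κ' u' x z a b⟩
  have hbT₁₂ : ∃ B₁₂ : ℝ, ∀ κ u κ' u' x z a b,
      |legStep₃ (kc l) (Kf (l + 1) - Kf l) (Kf (l + 1)) (Kf (l + 1)) N (fun κ u κ' u' => bsum N (W κ u κ' u')) κ u κ' u' x z a b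
        + legStep₃ (kc l) (Kf l) (Kf (l + 1) - Kf l) (Kf (l + 1)) N (fun κ u κ' u' => bsum N (W κ u κ' u')) κ u κ' u' x z a b| ≤ B₁₂ := by
    obtain ⟨B₁, h₁⟩ := hbT₁
    obtain ⟨B₂, h₂⟩ := hbT₂
    exact ⟨B₁ + B₂, fun κ u κ' u' x z a b => (abs_add_le _ _).trans (add_le_add (h₁ κ u κ' u' x z a b) (h₂ κ u κ' u' x z a b))⟩
  -- the bottom-step difference, as a table, is the sum of the three mixed steps (part 9 §3)
  have hdiff : legStepB kc Kf N (l + 1) W - legStepB kc Kf N l W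
      = (fun κ u κ' u' => legStep₃ (kc l) (Kf (l + 1) - Kf l) (Kf (l + 1)) (Kf (l + 1)) N (fun κ u κ' u' => bsum N (W κ u κ' u')) κ u κ' u')
        + (fun κ u κ' u' => legStep₃ (kc l) (Kf l) (Kf (l + 1) - Kf l) (Kf (l + 1)) N (fun κ u κ' u' => bsum N (W κ u κ' u')) κ u κ' u')
        + (fun κ u κ' u' => legStep₃ (kc l) (Kf l) (Kf l) (Kf (l + 1) - Kf l) N (fun κ u κ' u' => bsum N (W κ u κ' u')) κ u κ' u') := by
    funext κ u κ' u'
    show legStep (kc (l + 1)) (Kf (l + 1)) (Kf (l + 1)) N (fun κ u κ' u' => bsum N (W κ u κ' u')) κ u κ' u'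
        - legStep (kc l) (Kf l) (Kf l) N (fun κ u κ' u' => bsum N (W κ u κ' u')) κ u κ' u'
      = legStep₃ (kc l) (Kf (l + 1) - Kf l) (Kf (l + 1)) (Kf (l + 1)) N (fun κ u κ' u' => bsum N (W κ u κ' u')) κ u κ' u'
        + legStep₃ (kc l) (Kf l) (Kf (l + 1) - Kf l) (Kf (l + 1)) N (fun κ u κ' u' => bsum N (W κ u κ' u')) κ u κ' u'
        + legStep₃ (kc l) (Kf l) (Kf l) (Kf (l + 1) - Kf l) N (fun κ u κ' u' => bsum N (W κ u κ' u')) κ u κ' u'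
    rw [hkc]
    exact legStep_sub_legStep_eq_three (N := N) hK₀ hδ₀ hC₀ hK₁ hδ₁ (kc l) hBW κ u κ' u'
  rw [hdiff, legChain_bsumPow_add hK (l + 2) q q
      (X := (fun κ u κ' u' => legStep₃ (kc l) (Kf (l + 1) - Kf l) (Kf (l + 1)) (Kf (l + 1)) N (fun κ u κ' u' => bsum N (W κ u κ' u')) κ u κ' u')
        + (fun κ u κ' u' => legStep₃ (kc l) (Kf l) (Kf (l + 1) - Kf l) (Kf (l + 1)) N (fun κ u κ' u' => bsum N (W κ u κ' u')) κ u κ' u'))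
      hbT₁₂ hbT₃,
    legChain_bsumPow_add hK (l + 2) q q hbT₁ hbT₂]

/-- NOT IN PRINT; OUR BOOKKEEPING.  **`HΔw` FROM THREE MIXED-WINDOW BOUNDS**: if the three mixed windows of `legChain_stepDiff_eq_three` obey `LocStencil₂ · cᵢ δ′`
then the `HΔw` object obeys `LocStencil₂ · (c₁ + c₂ + c₃) δ′` (the identity ⨾ `BalabanStepW2.locStencil₂_add'` twice).  The consumer takes `cᵢ := (Aᵢ·C + Bᵢ·g)·θ^l`. -/
theorem locStencil₂_stepDiff_of_three (hK : ∀ n, ∃ δ C : ℝ, 0 < δ ∧ Decays (Kf n) C δ) {l : ℕ} (hkc : kc (l + 1) = kc l) (q : ℕ)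
    {W : Tab d} (hW : ∃ B : ℝ, ∀ κ u κ' u' x z a b, |W κ u κ' u' x z a b| ≤ B) {c₁ c₂ c₃ δ' : ℝ}
    (h₁ : BalabanCompositeJets.LocStencil₂ (legChain kc Kf N (l + 2) q (fun κ u κ' u' => bsumPow N q
            (legStep₃ (kc l) (Kf (l + 1) - Kf l) (Kf (l + 1)) (Kf (l + 1)) N (fun κ u κ' u' => bsum N (W κ u κ' u')) κ u κ' u'))) c₁ δ')
    (h₂ : BalabanCompositeJets.LocStencil₂ (legChain kc Kf N (l + 2) q (fun κ u κ' u' => bsumPow N q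
            (legStep₃ (kc l) (Kf l) (Kf (l + 1) - Kf l) (Kf (l + 1)) N (fun κ u κ' u' => bsum N (W κ u κ' u')) κ u κ' u'))) c₂ δ')
    (h₃ : BalabanCompositeJets.LocStencil₂ (legChain kc Kf N (l + 2) q (fun κ u κ' u' => bsumPow N q
            (legStep₃ (kc l) (Kf l) (Kf l) (Kf (l + 1) - Kf l) N (fun κ u κ' u' => bsum N (W κ u κ' u')) κ u κ' u'))) c₃ δ') :
    BalabanCompositeJets.LocStencil₂
      (legChain kc Kf N (l + 2) q (fun κ u κ' u' => bsumPow N q ((legStepB kc Kf N (l + 1) W - legStepB kc Kf N l W) κ u κ' u')))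
      (c₁ + c₂ + c₃) δ' := by
  rw [legChain_stepDiff_eq_three hK hkc q hW]
  exact BalabanStepW2.locStencil₂_add' (BalabanStepW2.locStencil₂_add' h₁ h₂) h₃

end Summit.QuantumFields.BalabanUV.Beta.GAN24.StepDifferenceThreeWindows

end
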